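import Literature.AnabelianGeometry.EtaleTheta.Discharge.Sec5EnvelopeTopology

/-!
# [EtTh] §5, Lemma 5.8 / 5.9 (iv): the `K^×`-part of `D ⊆ Out(E^Π_N)` — "conjugation by `(K^×)^{1/N}`" through the natural action on `O^×(B_N^birat)` (pp. 331–332 / PDF pp. 105–106)

Mochizuki, *The étale theta function and its Frobenioid-theoretic manifestations*, Publ. RIMS **45**
(2009) [cite: MochizukiEtTh2009, Lem 5.8 p.331 (PDF p.105)].  Layer L2 of the abc-iut cell, seat
abc-iut-L2-t11 (gen 2), MERGE-PLAN row 11 of the §5 owner abc-iut-L2-t4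
(HOME/staging/L2/L2-t4/MERGE-PLAN.md).  ADDITIVE: a small DEFINITIONS file over abc-iut-L2-t4's FROZEN
`FrobenioidTheta.lean` / `FrobenioidThetaBiKummer.lean` / `FrobenioidMonoTheta(Env).lean`; nothing landed
is edited.  The proofs that use it (transport along `E^Π_N ⥲ Π^tp_Y[μ_N]`, Lemma 5.9 (iv)) are in the
proof-only companion `Discharge/Sec5KummerOutTransport.lean`.

WHAT THIS FILE IS FOR.  Lemma 5.8 (p.331 (PDF p.105)): "write `(K^×)^{1/N} ⊆ O^×(B_N^birat)` for the
subgroup of elements whose `N`-th power lies in the image of the natural inclusion `K^× ↪ O^×(B_N^birat)`;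
`(O_K^×)^{1/N} := (K^×)^{1/N} ∩ O^×(B_N)`.  Then `(O_K^×)^{1/N}` is equal to the set of elements of
`O^×(B_N)` that normalize the subgroup `E_N ⊆ Aut_C(B_N)`.  In particular, we have a natural outer action
of `(O_K^×)^{1/N}/μ_N(B_N) ⥲ O_K^×` on `E_N`; this outer action extends to an outer action of
`(K^×)^{1/N}/μ_N(B_N) ⥲ K^×` on `E_N`."  Lemma 5.9 (iv) (p.332 (PDF p.106)) then forms "the subgroup of
`Out(E^Π_N)` generated by the natural outer actions of `l·ℤ` [cf. (iii)], `K^×` [cf. Lemma 5.8] on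
`E_N`", to be matched with `D_Y` = "the subgroup of `Out(Π^tp_Y[μ_N])` generated by the image of `K^×`,
`Gal(Y/X)`" (Def. 2.13 (i), p.273 (PDF p.47)).  abc-iut-L2-t4's `frdBiThetaEnv` (`FrobenioidMonoThetaEnv.lean`)
carries the `l·ℤ`-part (`galOut`) and the `(O_K^×)^{1/N}`-part (`constOut`: conjugation by `(u, 1)`) and
leaves the REST of the `K^×`-part as a PARAMETER `DK : Set (TopOut E^Π_N)` ("needs the birationalization
`Aut_{C^birat}(B_N^birat)`, which the §5 data stub does not carry" — their module docstring); with
`DK := ∅` the comparison hypothesis `KummerOutReached` of `Discharge/Sec5EnvelopeTopology.lean` is NOT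
expected to hold in the genuine situation (abc-iut-L2-t4 CAVEAT, MERGE-PLAN row 11: the valuation part of
`Im(K^× → H¹(G_K, μ_N))` is missed).  This file supplies the honest `DK`:
* `BiratAutAction 𝔉` — the ONE extra datum the extension needs, "the natural action" of `Aut_C(B_N)` on
  `O^×(B_N^birat)` (Def. 4.1 (iii), p.313 (PDF p.87): "`f ∈ O^×(A^birat)` … fixed by the natural action of
  `H_A`", `H_A ⊆ Aut_C(A)/O^×(A)`; functoriality of `C → C^birat`, [FrdI] Prop. 4.4) — a hypothesis
  structure in the exact shape of abc-iut-L2-t3's `BiKummerSetting.biratAut : Aut A →* MulAut O^×(A^birat)`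
  (`BiKummer.lean`, BUILT), so that the merge (MERGE-PLAN §2a) is an instantiation, with its three
  structural laws as fields (equivariance of `O^×(B_N) ↪ O^×(B_N^birat)`, triviality on `O^×(B_N)`,
  constants fixed); NO statement of §5 is a field;
* `BiratAutAction.kummerCocycle` — the Kummer cocycle `κ_f(e) := (e·f)·f⁻¹ ∈ μ_N(B_N)` of
  `f ∈ (K^×)^{1/N}` (abc-iut-L2-t4's `KxRootN`) on `Aut_C(B_N)`: an `N`-torsion element of `O^×(B_N^birat)`
  (`f^N ∈ K^×` is fixed), which lies in `μ_N(B_N)` by "`(K^×)^{1/N}/μ_N(B_N) ⥲ K^×`" (abc-iut-L2-t4's named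
  fact `KxRootNModCyclotome`, consumed BY NAME); its cocycle law and triviality on `O^×(B_N)` PROVED;
* `BiratAutAction.kummerEnd f` / `kummerAutHom f` — "conjugation by `f`" on `E^Π_N`: `(e, y) ↦ (κ_f(e)⁻¹ · e, y)`
  (in `Aut_{C^birat}(B_N^birat)`: `f ∘ e ∘ f⁻¹ = (f · (e·f)⁻¹) ∘ e`), a bi-continuous automorphism; the
  homomorphisms `(K^×)^{1/N} → Aut(E^Π_N) → Out(E^Π_N)` (`kummerAutHom`, `kummerOutHom`), and
  **`BiratAutAction.kummerOut`** `:= Im((K^×)^{1/N} → Out(E^Π_N))` — the `K^×`-part of `D`;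
* in the proof-only companion `Discharge/Sec5KummerOutTransport.lean`: for `u ∈ (O_K^×)^{1/N}` "conjugation
  by `u`" IS abc-iut-L2-t4's `constOut` generator (so `⟨galOut ∪ constOut ∪ kummerOut⟩ = ⟨galOut ∪ kummerOut⟩`),
  `μ_N(B_N) ⊆ (K^×)^{1/N}` acts by INNER automorphisms (the outer action is one of "`(K^×)^{1/N}/μ_N(B_N)`"),
  and transport along `E^Π_N ⥲ Π^tp_Y[μ_N]` (Lemma 5.9 (iv)) = abc-iut-L2-t2's Kummer cocycle shifts.
HONEST FRAMING: definitions + kernel-checked bookkeeping over the typed §5 interface; the birational action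
is a hypothesis structure (TODO-merge(abc-iut-L2-t3/abc-iut-L2-t9): instantiate from `biratAut` /
`biratAutModel`); nothing of [EtTh] is asserted; typed ≠ proved; no side is taken on anything downstream.
-/

namespace Literature.AnabelianGeometry.EtaleTheta

open CategoryTheory

universe w v v' u u'

namespace ThetaFrobenioid

variable {C : Type u} [Category.{v} C] {D : Type u'} [Category.{v'} D] (𝔉 : ThetaFrobenioid.{w} C D)

/-- `μ_N(B_N) ↪ O^×(B_N) ↪ O^×(B_N^birat)` ("`(O_K^×)^{1/N} := (K^×)^{1/N} ∩ O^×(B_N)`" is formed inside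
`O^×(B_N^birat)` along "the natural inclusion", Lemma 5.8, p.331 (PDF p.105)); the map of abc-iut-L2-t4's
`KxRootNModCyclotome`.  [cite: MochizukiEtTh2009, Lem 5.8 p.331 (PDF p.105)] -/
abbrev muToBirat : 𝔉.muTorsion 𝔉.BN 𝔉.N →* 𝔉.biratUnits 𝔉.BN :=
  (𝔉.unitsToBirat 𝔉.BN).comp (Subgroup.inclusion (𝔉.muTorsion_le_units 𝔉.BN 𝔉.N))

/-- `μ_N(B_N) → O^×(B_N^birat)` is injective (both inclusions are).
[cite: MochizukiEtTh2009, Lem 5.8 p.331 (PDF p.105)] -/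
theorem muToBirat_injective : Function.Injective 𝔉.muToBirat :=
  (𝔉.unitsToBirat_injective 𝔉.BN).comp (Subgroup.inclusion_injective _)

/-- **HYPOTHESIS STRUCTURE — `TODO-merge(abc-iut-L2-t3, abc-iut-L2-t9)`.**  "The natural action" of
`Aut_C(B_N)` on `O^×(B_N^birat)` (Def. 4.1 (iii), p.313 (PDF p.87): "`f ∈ O^×(A^birat)` is an element fixed
by the natural action of `H_A`", where `H_A ⊆ Aut_C(A)/O^×(A)`, Def. 4.1 (ii)) — the functoriality of
`C → C^birat` ([FrdI] Prop. 4.4) on automorphisms, which the §5 data stub `TemperedFrobenioidStub` does not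
carry (abc-iut-L2-t4, `FrobenioidMonoThetaEnv.lean`: "needs the birationalization `Aut_{C^birat}(B_N^birat)`").
Shape = abc-iut-L2-t3's field `BiKummerSetting.biratAut : Aut A →* MulAut (biratUnits A)` at `A := B_N`,
with the three structural laws print uses in Lemma 5.8 as fields.  DATA for the `K^×`-part of `D`; no
statement of §5 is a field.  [cite: MochizukiEtTh2009, Def 4.1 (iii) p.313 (PDF p.87)] -/
structure BiratAutAction where
  /-- the natural action `Aut_C(B_N) → Aut(O^×(B_N^birat))`, `e ↦ (f ↦ e·f)` (conjugation in
  `Aut_{C^birat}(B_N^birat)`; abc-iut-L2-t3's `biratAut B_N`). -/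
  act : Aut 𝔉.BN →* MulAut (𝔉.biratUnits 𝔉.BN)
  /-- "the natural inclusion" `O^×(B_N) ↪ O^×(B_N^birat)` (p.331 (PDF p.105)) is `Aut_C(B_N)`-equivariant:
  `e·u = e ∘ u ∘ e⁻¹` for `u ∈ O^×(B_N)` (both sides are conjugation in `C^birat`). -/
  act_unitsToBirat : ∀ (e : Aut 𝔉.BN) (u : 𝔉.units 𝔉.BN),
    act e (𝔉.unitsToBirat 𝔉.BN u) =
      𝔉.unitsToBirat 𝔉.BN ⟨e * (u : Aut 𝔉.BN) * e⁻¹, (𝔉.units_normal 𝔉.BN).conj_mem _ u.2 e⟩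
  /-- `O^×(B_N)` acts trivially: the action is one of `Aut_C(B_N)/O^×(B_N)` ("the natural action of
  `H_A`", `H_A ⊆ Aut_C(A)/O^×(A)`, Def. 4.1 (ii)/(iii), p.313 (PDF p.87); `O^×(B_N) ⊆ O^×(B_N^birat)` is
  abelian). -/
  act_units : ∀ u : 𝔉.units 𝔉.BN, act (u : Aut 𝔉.BN) = 1
  /-- the constants are fixed: "the natural inclusion `K^× ↪ O^×(B_N^birat)`" (Lemma 5.8) lands in the
  `Aut_C(B_N)`-invariants (Def. 3.6 (iii): the constants `K` of the tempered Frobenioid; [EtTh] §3). -/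
  act_constEmb : ∀ (e : Aut 𝔉.BN) (k : (𝔉.K)ˣ), act e (𝔉.constEmb k) = 𝔉.constEmb k

namespace BiratAutAction

variable {𝔉} (α : 𝔉.BiratAutAction)

/-! ### The Kummer cocycle of an `N`-th root of a constant (proof of Lemma 5.8, p.331) -/

/-- `e·f^N = f^N` for `f ∈ (K^×)^{1/N}` (`f^N ∈ K^×` is a constant, fixed by the action).
[cite: MochizukiEtTh2009, Lem 5.8 p.331 (PDF p.105)] -/
theorem act_pow_N (f : 𝔉.KxRootN) (e : Aut 𝔉.BN) :
    α.act e ((f : 𝔉.biratUnits 𝔉.BN) ^ (𝔉.N : ℕ)) = (f : 𝔉.biratUnits 𝔉.BN) ^ (𝔉.N : ℕ) := by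
  obtain ⟨k, hk⟩ := MonoidHom.mem_range.mp (𝔉.mem_KxRootN.mp f.2)
  rw [← hk, α.act_constEmb]

/-- `(e·f)·f⁻¹` is `N`-torsion in `O^×(B_N^birat)` for `f ∈ (K^×)^{1/N}`.
[cite: MochizukiEtTh2009, Lem 5.8 p.331 (PDF p.105)] -/
theorem rawCocycle_pow_N (f : 𝔉.KxRootN) (e : Aut 𝔉.BN) :
    (α.act e (f : 𝔉.biratUnits 𝔉.BN) * (f : 𝔉.biratUnits 𝔉.BN)⁻¹) ^ (𝔉.N : ℕ) = 1 := by
  rw [mul_pow, ← map_pow, α.act_pow_N, inv_pow, mul_inv_cancel]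

/-- `(e·f)·f⁻¹ ∈ μ_N(B_N)` (inside `O^×(B_N^birat)`): by "`(K^×)^{1/N}/μ_N(B_N) ⥲ K^×`" (Lemma 5.8; abc-iut-L2-t4's
named fact `KxRootNModCyclotome`, second clause: the `N`-torsion of `(K^×)^{1/N}` is `μ_N(B_N)`) applied to
the `N`-torsion element `(e·f)·f⁻¹ ∈ (K^×)^{1/N}`.  [cite: MochizukiEtTh2009, Lem 5.8 p.331 (PDF p.105)] -/
theorem rawCocycle_mem_range (hK : 𝔉.KxRootNModCyclotome) (f : 𝔉.KxRootN) (e : Aut 𝔉.BN) :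
    α.act e (f : 𝔉.biratUnits 𝔉.BN) * (f : 𝔉.biratUnits 𝔉.BN)⁻¹ ∈ 𝔉.muToBirat.range := by
  have hx : α.act e (f : 𝔉.biratUnits 𝔉.BN) * (f : 𝔉.biratUnits 𝔉.BN)⁻¹ ∈ 𝔉.KxRootN := by
    rw [𝔉.mem_KxRootN, α.rawCocycle_pow_N]
    exact one_mem _
  exact (hK.2 _ hx).mp (α.rawCocycle_pow_N f e)

/-- **The Kummer cocycle `κ_f : Aut_C(B_N) → μ_N(B_N)`** of `f ∈ (K^×)^{1/N}`: `κ_f(e) := (e·f)·f⁻¹`, the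
element of `μ_N(B_N)` by which `e` "acts via multiplication" on `f` (proof of Lemma 5.8, p.331 (PDF p.105):
"the set of elements on which `Π^tp_Y` [i.e., `G_K`, via the natural surjection `Π^tp_Y ↠ G_K`] acts via
multiplication by an element of `μ_N(B_N)`").  [cite: MochizukiEtTh2009, Lem 5.8 p.331 (PDF p.105)] -/
noncomputable def kummerCocycle (hK : 𝔉.KxRootNModCyclotome) (f : 𝔉.KxRootN) (e : Aut 𝔉.BN) :
    𝔉.muTorsion 𝔉.BN 𝔉.N :=
  Classical.choose (MonoidHom.mem_range.mp (α.rawCocycle_mem_range hK f e))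

/-- Defining property of `κ_f(e)`: its image in `O^×(B_N^birat)` is `(e·f)·f⁻¹`.
[cite: MochizukiEtTh2009, Lem 5.8 p.331 (PDF p.105)] -/
theorem muToBirat_kummerCocycle (hK : 𝔉.KxRootNModCyclotome) (f : 𝔉.KxRootN) (e : Aut 𝔉.BN) :
    𝔉.muToBirat (α.kummerCocycle hK f e) =
      α.act e (f : 𝔉.biratUnits 𝔉.BN) * (f : 𝔉.biratUnits 𝔉.BN)⁻¹ :=
  Classical.choose_spec (MonoidHom.mem_range.mp (α.rawCocycle_mem_range hK f e))

/-- The conjugate `e ∘ u ∘ e⁻¹` of `u ∈ μ_N(B_N)` by `e ∈ Aut_C(B_N)`, as an element of `μ_N(B_N)` (normal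
subgroup).  [cite: MochizukiEtTh2009, §5 p.331 (PDF p.105)] -/
abbrev conjMu (e : Aut 𝔉.BN) (u : 𝔉.muTorsion 𝔉.BN 𝔉.N) : 𝔉.muTorsion 𝔉.BN 𝔉.N :=
  ⟨e * (u : Aut 𝔉.BN) * e⁻¹, (𝔉.muTorsion_normal 𝔉.BN 𝔉.N).conj_mem _ u.2 e⟩

/-- `O^×(B_N^birat)`-image of a conjugate: `e·u` (equivariance of `O^×(B_N) ↪ O^×(B_N^birat)`).
[cite: MochizukiEtTh2009, Lem 5.8 p.331 (PDF p.105)] -/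
theorem muToBirat_conjMu (e : Aut 𝔉.BN) (u : 𝔉.muTorsion 𝔉.BN 𝔉.N) :
    𝔉.muToBirat (conjMu e u) = α.act e (𝔉.muToBirat u) := by
  change 𝔉.unitsToBirat 𝔉.BN _ = α.act e (𝔉.unitsToBirat 𝔉.BN _)
  rw [α.act_unitsToBirat]
  rfl

/-- **Cocycle law**: `κ_f(e ∘ e') = κ_f(e) · (e ∘ κ_f(e') ∘ e⁻¹)`.
[cite: MochizukiEtTh2009, Lem 5.8 p.331 (PDF p.105)] -/
theorem kummerCocycle_mul (hK : 𝔉.KxRootNModCyclotome) (f : 𝔉.KxRootN) (e e' : Aut 𝔉.BN) :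
    α.kummerCocycle hK f (e * e') = α.kummerCocycle hK f e * conjMu e (α.kummerCocycle hK f e') := by
  apply 𝔉.muToBirat_injective
  rw [map_mul, α.muToBirat_conjMu, α.muToBirat_kummerCocycle, α.muToBirat_kummerCocycle,
    α.muToBirat_kummerCocycle, map_mul, MulAut.mul_apply, map_mul, map_inv]
  simp only [mul_assoc, mul_comm, mul_left_comm, mul_inv_cancel_comm_assoc]

/-- `κ_f(1) = 1`. [cite: MochizukiEtTh2009, Lem 5.8 p.331 (PDF p.105)] -/
theorem kummerCocycle_one (hK : 𝔉.KxRootNModCyclotome) (f : 𝔉.KxRootN) :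
    α.kummerCocycle hK f 1 = 1 := by
  apply 𝔉.muToBirat_injective
  rw [α.muToBirat_kummerCocycle, map_one, MulAut.one_apply, mul_inv_cancel, map_one]

/-- `κ_f(u) = 1` for `u ∈ O^×(B_N)` (units act trivially on `O^×(B_N^birat)`).
[cite: MochizukiEtTh2009, Lem 5.8 p.331 (PDF p.105)] -/
theorem kummerCocycle_of_mem_units (hK : 𝔉.KxRootNModCyclotome) (f : 𝔉.KxRootN) {u : Aut 𝔉.BN}
    (hu : u ∈ 𝔉.units 𝔉.BN) : α.kummerCocycle hK f u = 1 := by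
  apply 𝔉.muToBirat_injective
  rw [α.muToBirat_kummerCocycle, α.act_units ⟨u, hu⟩, MulAut.one_apply, mul_inv_cancel, map_one]

/-- `κ_f(u ∘ e) = κ_f(e)` for `u ∈ O^×(B_N)` (`O^×(B_N)` is abelian and acts trivially).
[cite: MochizukiEtTh2009, Lem 5.8 p.331 (PDF p.105)] -/
theorem kummerCocycle_units_mul (hK : 𝔉.KxRootNModCyclotome) (f : 𝔉.KxRootN) {u : Aut 𝔉.BN}
    (hu : u ∈ 𝔉.units 𝔉.BN) (e : Aut 𝔉.BN) :
    α.kummerCocycle hK f (u * e) = α.kummerCocycle hK f e := by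
  rw [α.kummerCocycle_mul, α.kummerCocycle_of_mem_units hK f hu, one_mul]
  apply Subtype.ext
  change u * (α.kummerCocycle hK f e : Aut 𝔉.BN) * u⁻¹ = _
  rw [setLike_mul_comm (s := 𝔉.units 𝔉.BN) hu
    (𝔉.muTorsion_le_units 𝔉.BN 𝔉.N (α.kummerCocycle hK f e).2), mul_inv_cancel_right]

/-- `κ_{f·g} = κ_f · κ_g` (the action is by group automorphisms).
[cite: MochizukiEtTh2009, Lem 5.8 p.331 (PDF p.105)] -/
theorem kummerCocycle_mul_root (hK : 𝔉.KxRootNModCyclotome) (f g : 𝔉.KxRootN) (e : Aut 𝔉.BN) :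
    α.kummerCocycle hK (f * g) e = α.kummerCocycle hK f e * α.kummerCocycle hK g e := by
  apply 𝔉.muToBirat_injective
  rw [map_mul, α.muToBirat_kummerCocycle, α.muToBirat_kummerCocycle, α.muToBirat_kummerCocycle,
    Subgroup.coe_mul, map_mul, mul_inv]
  simp only [mul_assoc, mul_comm, mul_left_comm]

/-! ### "Conjugation by `f ∈ (K^×)^{1/N}`" on `E^Π_N` (Lemma 5.8 "extends to an outer action of `(K^×)^{1/N}/μ_N(B_N)`") -/

/-- `κ_f(e)⁻¹ ∘ e ∈ E_N` for `e ∈ E_N` (`μ_N(B_N) ⊆ E_N`). [cite: MochizukiEtTh2009, Lem 5.8 p.331 (PDF p.105)] -/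
theorem inv_kummerCocycle_mul_mem_EN (hK : 𝔉.KxRootNModCyclotome) (f : 𝔉.KxRootN) {e : Aut 𝔉.BN}
    (he : e ∈ 𝔉.EN) : ((α.kummerCocycle hK f e : 𝔉.muTorsion 𝔉.BN 𝔉.N) : Aut 𝔉.BN)⁻¹ * e ∈ 𝔉.EN :=
  𝔉.EN.mul_mem (𝔉.EN.inv_mem (le_sectionSubgroup _ _ _ (α.kummerCocycle hK f e).2)) he

/-- **"Conjugation by `f`" as an endomorphism of `E^Π_N`**: `(e, y) ↦ (κ_f(e)⁻¹ ∘ e, y)` — in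
`Aut_{C^birat}(B_N^birat)` one has `f ∘ e ∘ f⁻¹ = (f · (e·f)⁻¹) ∘ e = κ_f(e)⁻¹ ∘ e`; the `Π^tp_Y̲`-coordinate
is untouched (Lemma 5.8: an outer action "on `E_N`").  [cite: MochizukiEtTh2009, Lem 5.8 p.331 (PDF p.105)] -/
noncomputable def kummerEnd (hK : 𝔉.KxRootNModCyclotome) (f : 𝔉.KxRootN) : 𝔉.EPiN →* 𝔉.EPiN where
  toFun x := ⟨(((α.kummerCocycle hK f x.1.1 : 𝔉.muTorsion 𝔉.BN 𝔉.N) : Aut 𝔉.BN)⁻¹ * x.1.1, x.1.2),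
    ⟨α.inv_kummerCocycle_mul_mem_EN hK f x.2.1, x.2.2.1, by
      have hk := 𝔉.muTorsion_le_ker 𝔉.BN 𝔉.N ((𝔉.muTorsion 𝔉.BN 𝔉.N).inv_mem (α.kummerCocycle hK f x.1.1).2)
      rw [MonoidHom.mem_ker] at hk
      change 𝔉.autBase 𝔉.BN (_ * x.1.1) = 𝔉.ρ x.1.2
      rw [map_mul, hk, one_mul, x.2.2.2]⟩⟩
  map_one' := by
    apply Subtype.ext
    change ((((α.kummerCocycle hK f 1 : 𝔉.muTorsion 𝔉.BN 𝔉.N) : Aut 𝔉.BN))⁻¹ * 1, (1 : 𝔉.PiX)) = (1, 1)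
    rw [α.kummerCocycle_one, Subgroup.coe_one, inv_one, mul_one]
  map_mul' x x' := by
    apply Subtype.ext
    change ((((α.kummerCocycle hK f (x.1.1 * x'.1.1) : 𝔉.muTorsion 𝔉.BN 𝔉.N) : Aut 𝔉.BN))⁻¹ *
        (x.1.1 * x'.1.1), x.1.2 * x'.1.2) =
      ((((α.kummerCocycle hK f x.1.1 : 𝔉.muTorsion 𝔉.BN 𝔉.N) : Aut 𝔉.BN))⁻¹ * x.1.1 *
        ((((α.kummerCocycle hK f x'.1.1 : 𝔉.muTorsion 𝔉.BN 𝔉.N) : Aut 𝔉.BN))⁻¹ * x'.1.1),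
        x.1.2 * x'.1.2)
    refine Prod.ext ?_ rfl
    change _ = _ * _
    have hc : (((α.kummerCocycle hK f x.1.1 : 𝔉.muTorsion 𝔉.BN 𝔉.N) : Aut 𝔉.BN))⁻¹ *
        (x.1.1 * ((α.kummerCocycle hK f x'.1.1 : 𝔉.muTorsion 𝔉.BN 𝔉.N) : Aut 𝔉.BN) * x.1.1⁻¹)⁻¹ =
      (x.1.1 * ((α.kummerCocycle hK f x'.1.1 : 𝔉.muTorsion 𝔉.BN 𝔉.N) : Aut 𝔉.BN) * x.1.1⁻¹)⁻¹ *
        (((α.kummerCocycle hK f x.1.1 : 𝔉.muTorsion 𝔉.BN 𝔉.N) : Aut 𝔉.BN))⁻¹ :=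
      setLike_mul_comm (s := 𝔉.units 𝔉.BN)
        ((𝔉.units 𝔉.BN).inv_mem (𝔉.muTorsion_le_units 𝔉.BN 𝔉.N (α.kummerCocycle hK f x.1.1).2))
        ((𝔉.units 𝔉.BN).inv_mem (𝔉.muTorsion_le_units 𝔉.BN 𝔉.N
          (conjMu x.1.1 (α.kummerCocycle hK f x'.1.1)).2))
    rw [α.kummerCocycle_mul, Subgroup.coe_mul, mul_inv_rev]
    change (x.1.1 * ((α.kummerCocycle hK f x'.1.1 : 𝔉.muTorsion 𝔉.BN 𝔉.N) : Aut 𝔉.BN) * x.1.1⁻¹)⁻¹ *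
        (((α.kummerCocycle hK f x.1.1 : 𝔉.muTorsion 𝔉.BN 𝔉.N) : Aut 𝔉.BN))⁻¹ * (x.1.1 * x'.1.1) = _
    rw [← hc]
    group

/-- Underlying pair of `kummerEnd f x`. [cite: MochizukiEtTh2009, Lem 5.8 p.331 (PDF p.105)] -/
@[simp] theorem coe_kummerEnd (hK : 𝔉.KxRootNModCyclotome) (f : 𝔉.KxRootN) (x : 𝔉.EPiN) :
    ((α.kummerEnd hK f x : 𝔉.EPiN) : Aut 𝔉.BN × 𝔉.PiX) =
      ((((α.kummerCocycle hK f x.1.1 : 𝔉.muTorsion 𝔉.BN 𝔉.N) : Aut 𝔉.BN))⁻¹ * x.1.1, x.1.2) := rfl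

/-- `kummerEnd` is multiplicative in `f`: conjugation by `f·g` = (by `f`) ∘ (by `g`).
[cite: MochizukiEtTh2009, Lem 5.8 p.331 (PDF p.105)] -/
theorem kummerEnd_mul_apply (hK : 𝔉.KxRootNModCyclotome) (f g : 𝔉.KxRootN) (x : 𝔉.EPiN) :
    α.kummerEnd hK (f * g) x = α.kummerEnd hK f (α.kummerEnd hK g x) := by
  apply Subtype.ext
  rw [coe_kummerEnd, coe_kummerEnd, coe_kummerEnd]
  refine Prod.ext ?_ rfl
  change (((α.kummerCocycle hK (f * g) x.1.1 : 𝔉.muTorsion 𝔉.BN 𝔉.N) : Aut 𝔉.BN))⁻¹ * x.1.1 =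
    (((α.kummerCocycle hK f
        ((((α.kummerCocycle hK g x.1.1 : 𝔉.muTorsion 𝔉.BN 𝔉.N) : Aut 𝔉.BN))⁻¹ * x.1.1) :
          𝔉.muTorsion 𝔉.BN 𝔉.N) : Aut 𝔉.BN))⁻¹ *
      ((((α.kummerCocycle hK g x.1.1 : 𝔉.muTorsion 𝔉.BN 𝔉.N) : Aut 𝔉.BN))⁻¹ * x.1.1)
  have hκ : α.kummerCocycle hK f
      ((((α.kummerCocycle hK g x.1.1 : 𝔉.muTorsion 𝔉.BN 𝔉.N) : Aut 𝔉.BN))⁻¹ * x.1.1) =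
        α.kummerCocycle hK f x.1.1 :=
    α.kummerCocycle_units_mul hK f
      ((𝔉.units 𝔉.BN).inv_mem (𝔉.muTorsion_le_units 𝔉.BN 𝔉.N (α.kummerCocycle hK g x.1.1).2)) _
  have hcomm : (((α.kummerCocycle hK g x.1.1 : 𝔉.muTorsion 𝔉.BN 𝔉.N) : Aut 𝔉.BN))⁻¹ *
      (((α.kummerCocycle hK f x.1.1 : 𝔉.muTorsion 𝔉.BN 𝔉.N) : Aut 𝔉.BN))⁻¹ =
      (((α.kummerCocycle hK f x.1.1 : 𝔉.muTorsion 𝔉.BN 𝔉.N) : Aut 𝔉.BN))⁻¹ *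
        (((α.kummerCocycle hK g x.1.1 : 𝔉.muTorsion 𝔉.BN 𝔉.N) : Aut 𝔉.BN))⁻¹ :=
    setLike_mul_comm (s := 𝔉.units 𝔉.BN)
      ((𝔉.units 𝔉.BN).inv_mem (𝔉.muTorsion_le_units 𝔉.BN 𝔉.N (α.kummerCocycle hK g x.1.1).2))
      ((𝔉.units 𝔉.BN).inv_mem (𝔉.muTorsion_le_units 𝔉.BN 𝔉.N (α.kummerCocycle hK f x.1.1).2))
  rw [hκ, α.kummerCocycle_mul_root, Subgroup.coe_mul, mul_inv_rev, hcomm, mul_assoc]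

/-- Conjugation by `1` is the identity. [cite: MochizukiEtTh2009, Lem 5.8 p.331 (PDF p.105)] -/
theorem kummerEnd_one_apply (hK : 𝔉.KxRootNModCyclotome) (x : 𝔉.EPiN) : α.kummerEnd hK 1 x = x := by
  apply Subtype.ext
  rw [coe_kummerEnd]
  refine Prod.ext ?_ rfl
  change _ * _ = x.1.1
  have h1 : α.kummerCocycle hK 1 x.1.1 = 1 := by
    apply 𝔉.muToBirat_injective
    rw [α.muToBirat_kummerCocycle, Subgroup.coe_one, map_one, mul_inv_cancel, map_one]
  rw [h1, Subgroup.coe_one, inv_one, one_mul]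

/-- **The action `(K^×)^{1/N} → Aut(E^Π_N)`, `f ↦` "conjugation by `f`"** (Lemma 5.8: the outer action of
`(O_K^×)^{1/N}` "extends to an outer action of `(K^×)^{1/N}/μ_N(B_N) ⥲ K^×` on `E_N`"), as a homomorphism to
Mathlib's `MulAut`.  [cite: MochizukiEtTh2009, Lem 5.8 p.331 (PDF p.105)] -/
noncomputable def kummerAutHom (hK : 𝔉.KxRootNModCyclotome) : 𝔉.KxRootN →* MulAut 𝔉.EPiN where
  toFun f :=
    { toFun := α.kummerEnd hK f
      invFun := α.kummerEnd hK f⁻¹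
      left_inv := fun x => by
        rw [← α.kummerEnd_mul_apply, inv_mul_cancel, α.kummerEnd_one_apply]
      right_inv := fun x => by
        rw [← α.kummerEnd_mul_apply, mul_inv_cancel, α.kummerEnd_one_apply]
      map_mul' := map_mul _ }
  map_one' := by
    apply MulEquiv.ext
    intro x
    exact α.kummerEnd_one_apply hK x
  map_mul' f g := by
    apply MulEquiv.ext
    intro x
    exact α.kummerEnd_mul_apply hK f g x

/-- `kummerAutHom f` on elements. [cite: MochizukiEtTh2009, Lem 5.8 p.331 (PDF p.105)] -/
@[simp] theorem kummerAutHom_apply (hK : 𝔉.KxRootNModCyclotome) (f : 𝔉.KxRootN) (x : 𝔉.EPiN) :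
    α.kummerAutHom hK f x = α.kummerEnd hK f x := rfl

/-- "Conjugation by `f`" is bi-continuous for the evident topology on `E^Π_N` (`Aut_C(B_N)` discrete ×
`Π^tp_X̲`, abc-iut-L2-t4's `epinTopology`): it only changes the discrete coordinate, as a function of the
discrete coordinate.  [cite: MochizukiEtTh2009, Lem 5.9 (iv) p.332 (PDF p.106)] -/
theorem continuous_kummerEnd (hK : 𝔉.KxRootNModCyclotome) (f : 𝔉.KxRootN) :
    Continuous (α.kummerEnd hK f) := by
  letI : TopologicalSpace (Aut 𝔉.BN) := 𝔉.autDiscrete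
  haveI : DiscreteTopology (Aut 𝔉.BN) := ⟨rfl⟩
  letI : TopologicalSpace (Aut 𝔉.BN × 𝔉.PiX) := 𝔉.ambientTopology
  apply continuous_induced_rng.2
  change Continuous fun x : 𝔉.EPiN => ((α.kummerEnd hK f x : 𝔉.EPiN) : Aut 𝔉.BN × 𝔉.PiX)
  simp only [coe_kummerEnd]
  refine Continuous.prodMk ?_ ?_
  · exact (continuous_of_discreteTopology (f := fun e : Aut 𝔉.BN =>
        (((α.kummerCocycle hK f e : 𝔉.muTorsion 𝔉.BN 𝔉.N) : Aut 𝔉.BN))⁻¹ * e)).comp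
      (continuous_fst.comp continuous_induced_dom)
  · exact continuous_snd.comp continuous_induced_dom

/-- `kummerAutHom f ∈ Aut_top(E^Π_N)` (abc-iut-L2-t2's `contMulAut`).
[cite: MochizukiEtTh2009, Lem 5.9 (iv) p.332 (PDF p.106)] -/
theorem kummerAutHom_mem_contMulAut (hK : 𝔉.KxRootNModCyclotome) (f : 𝔉.KxRootN) :
    α.kummerAutHom hK f ∈ contMulAut 𝔉.EPiN :=
  ⟨α.continuous_kummerEnd hK f, α.continuous_kummerEnd hK f⁻¹⟩

/-- **The outer action `(K^×)^{1/N} → Out(E^Π_N)`** (Lemma 5.8; the `K^×`-generators of `D` in Lemma 5.9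
(iv)).  [cite: MochizukiEtTh2009, Lem 5.8 p.331 (PDF p.105)] -/
noncomputable def kummerOutHom (hK : 𝔉.KxRootNModCyclotome) : 𝔉.KxRootN →* TopOut 𝔉.EPiN :=
  (TopOut.mk 𝔉.EPiN).comp ((α.kummerAutHom hK).codRestrict (contMulAut 𝔉.EPiN)
    (α.kummerAutHom_mem_contMulAut hK))

/-- **The `K^×`-part of `D ⊆ Out(E^Π_N)`**: the image of `(K^×)^{1/N} → Out(E^Π_N)` ("the natural outer
action[s] of … `K^×` [cf. Lemma 5.8] on `E_N`", Lemma 5.9 (iv), p.332 (PDF p.106)) — the honest value of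
the parameter `DK` of abc-iut-L2-t4's `frdBiThetaEnv`.  [cite: MochizukiEtTh2009, Lem 5.9 (iv) p.332 (PDF p.106)] -/
def kummerOut (hK : 𝔉.KxRootNModCyclotome) : Set (TopOut 𝔉.EPiN) := Set.range (α.kummerOutHom hK)

/-- Membership in `kummerOut`. [cite: MochizukiEtTh2009, Lem 5.9 (iv) p.332 (PDF p.106)] -/
theorem mem_kummerOut_iff (hK : 𝔉.KxRootNModCyclotome) {o : TopOut 𝔉.EPiN} :
    o ∈ α.kummerOut hK ↔ ∃ f : 𝔉.KxRootN, α.kummerOutHom hK f = o := Iff.rfl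

/-- `kummerOutHom f` is the class of the bi-continuous automorphism `kummerAutHom f`.
[cite: MochizukiEtTh2009, Lem 5.9 (iv) p.332 (PDF p.106)] -/
theorem kummerOutHom_apply (hK : 𝔉.KxRootNModCyclotome) (f : 𝔉.KxRootN) :
    α.kummerOutHom hK f = TopOut.mk 𝔉.EPiN ⟨α.kummerAutHom hK f, α.kummerAutHom_mem_contMulAut hK f⟩ :=
  rfl

/-! ### The Kummer cocycle read on `Π^tp_Y` through the sections (for the comparison of Lemma 5.9 (iv)) -/

/-- The Kummer cocycle of `f ∈ (K^×)^{1/N}` read on abc-iut-L2-t2's `Π^tp_Y` through the section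
`y ↦ s^⊓-gp_N(ρ y)` and the dictionary `(ι, m)` of Lemma 5.9 (iv): `p ↦ m(κ_f(s^⊓-gp_N(ρ(ι⁻¹ p))))` — the
`μ_N`-valued function on `Π^tp_Y` by which "`Π^tp_Y` … acts via multiplication" on `f` (proof of Lemma 5.8,
p.331 (PDF p.105)); in print it is inflated from `G_K` ("[i.e., `G_K`, via the natural surjection
`Π^tp_Y ↠ G_K`]"), which is the arithmetic input of the companion file.
[cite: MochizukiEtTh2009, Lem 5.8 proof p.331 (PDF p.105)] -/
noncomputable def kummerCocycleY (hK : 𝔉.KxRootNModCyclotome) (f : 𝔉.KxRootN) (T : ThetaEnvData.{v} 𝔉.N)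
    (ι : 𝔉.PiX ≃* T.PiX) (m : 𝔉.muTorsion 𝔉.BN 𝔉.N ≃* T.mu) : T.PiY → T.mu :=
  fun p => m (α.kummerCocycle hK f (𝔉.sgpCap (𝔉.ρ (ι.symm (p : T.PiX)))))

/-- Value of `kummerCocycleY`. [cite: MochizukiEtTh2009, Lem 5.8 proof p.331 (PDF p.105)] -/
theorem kummerCocycleY_apply (hK : 𝔉.KxRootNModCyclotome) (f : 𝔉.KxRootN) (T : ThetaEnvData.{v} 𝔉.N)
    (ι : 𝔉.PiX ≃* T.PiX) (m : 𝔉.muTorsion 𝔉.BN 𝔉.N ≃* T.mu) (p : T.PiY) :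
    α.kummerCocycleY hK f T ι m p = m (α.kummerCocycle hK f (𝔉.sgpCap (𝔉.ρ (ι.symm (p : T.PiX))))) := rfl

end BiratAutAction

end ThetaFrobenioid

end Literature.AnabelianGeometry.EtaleTheta
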